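import Literature.Analysis.FluidPDE.MildL3Smooth
import Literature.Analysis.FluidPDE.KatoViscosityScaling
import Literature.Analysis.UnboundedOperators.HeatKernelBoundedData
import HarnessLib

/-!
# Kato's weighted `L³` theorem: reduction to unit viscosity

Analysis/FluidPDE support file for the discharge of the named fact
`Literature.Analysis.FluidPDE.kato_local_L3` (`MildL3Smooth.lean`; Kato 1984, Thm. 1;
Lemarié-Rieusset 2016, Thm. 7.5, PDF pp. 155–158 of doi:10.1201/b19556), which is stated for an
arbitrary viscosity `ν > 0`: there is an absolute `δ₀ > 0` such that for `u₀ ∈ L³(ℝ³)` weakly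
divergence free with `t^{1/4} ‖e^{νtΔ}u₀‖₆ ≤ δ₀ ν^{3/4}` on `(0, T₀)` there is a mild solution on
`[0, T₀)` in `C([0,T₀); L³)`, measurable, with `u(0) = u₀` and `‖u(t)‖_∞ ≤ C t^{-1/2}`.

The physical-space construction of the solution (Picard iteration on the Oseen–Koch–Tataru
kernel `Fluid.oseenKernel` of `e^{τΔ}ℙ∇·`, `KochTataru.lean`, `OseenKernelLp.lean`) is naturally
carried out at **unit viscosity**, the normalisation of Kato 1984, §1 ("we may assume `ν = 1`")
and of Rusin–Šverák 2011, §1. This file states the unit-viscosity form `kato_local_L3_unit` of the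
fact and **proves** `kato_local_L3_of_unit : kato_local_L3_unit → kato_local_L3` by the elementary
scaling `u(t, x) = ν w(ν t, x)` (`Fluid.timeRescale ν ν w`), which maps mild solutions with
viscosity `1` and datum `w₀ = ν⁻¹ u₀` to mild solutions with viscosity `ν` and datum `u₀`
(`Fluid.IsMildNSSolutionOn.timeRescale`, `KatoViscosityScaling.lean`). The power `ν^{3/4}` in the
smallness hypothesis of `kato_local_L3` is exactly what makes the hypothesis scale invariant:
`s^{1/4} ‖e^{sΔ}w₀‖₆ = ν^{-3/4} · t^{1/4} ‖e^{νtΔ}u₀‖₆` for `s = ν t`; the `L^∞` constant becomes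
`C √ν`.

* `kato_local_L3_unit` — the unit-viscosity statement (a `def … : Prop`, the instance `ν = 1`
  of `kato_local_L3`, cited as such);
* `aestronglyMeasurable_uncurry_timeRescale_Ioo` — space–time measurability on a bounded slab
  `(0, T) × E` under `u ↦ c • u(a ·)` (the tree's `aestronglyMeasurable_uncurry_timeRescale` is
  the `(0, ∞)` version);
* `kato_local_L3_of_unit`, and the trivial converse `kato_local_L3_unit_of` (so the two facts are
  equivalent, `kato_local_L3_iff_unit`).

## Mathlib / tree search

Tree (`lean search 'kato_local_L3|timeRescale|unit_viscosity'`): `kato_local_L3` and its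
consumers (`mild_L3_interior_bounded_of`, `kato_solution_le_div_sqrt_of_kato_facts`), the
scaling toolkit `Fluid.timeRescale`, `IsMildNSSolutionOn.timeRescale`,
`ContinuousInLpOn.timeRescale`, `aestronglyMeasurable_uncurry_timeRescale`,
`IsWeaklyDivFree.const_smul` (`KatoViscosityScaling.lean`), `map_stAffine_volume_restrict_preimage`
(`SpaceTimeRescaling.lean`), `heatExtension_const_smul` (`HeatKernelBoundedData.lean`); the
analogous equivalences `rusin_sverak_minimal_data_compact_iff_unit_viscosity`,
`rusin_sverak_weak_limit_blowup_iff_unit_viscosity`. No unit-viscosity form of `kato_local_L3`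
existed. Mathlib: `eLpNorm_const_smul`, `Real.sqrt_mul`, `MemLp.const_smul`.

## References

* T. Kato, *Strong `Lᵖ`-solutions of the Navier–Stokes equation in `ℝᵐ`, with applications to
  weak solutions*, Math. Z. 187 (1984) 471–480, Thm. 1 and §1 (normalisation `ν = 1`). [Kato1984]
* P. G. Lemarié-Rieusset, *The Navier–Stokes Problem in the 21st Century*, CRC Press 2016,
  doi:10.1201/b19556, Thm. 7.5 and its proof (PDF pp. 155–158). [LemarieRieusset2016]
* W. Rusin, V. Šverák, J. Funct. Anal. 260 (2011), §1 (unit viscosity). [RusinSverak2011]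
-/

noncomputable section

open MeasureTheory TopologicalSpace Set Function Filter
open _root_.Topology
open scoped ENNReal NNReal

namespace Literature.Analysis.FluidPDE

/-! ### Measurability transport on a bounded slab -/

section Measurability

variable {E : Type*} [NormedAddCommGroup E] [InnerProductSpace ℝ E] [FiniteDimensional ℝ E]
  [MeasurableSpace E] [BorelSpace E] {F : Type*} [NormedAddCommGroup F] [NormedSpace ℝ F]

/-- **Space–time measurability on a bounded slab is preserved by `u ↦ c • u(a ·)`** (`a > 0`):
if `u` is measurable on `(0, a T) × E` then `c • u(a ·)` is measurable on `(0, T) × E`, the map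
`(t, x) ↦ (a t, x)` being a quasi-measure-preserving bijection between the two slabs
(`Fluid.map_stAffine_volume_restrict_preimage`; the `(0, ∞)` version is
`aestronglyMeasurable_uncurry_timeRescale`). [folklore] -/
theorem aestronglyMeasurable_uncurry_timeRescale_Ioo {u : ℝ → E → F} {a T : ℝ} (ha : 0 < a)
    (hu : AEStronglyMeasurable (uncurry u)
      (volume.restrict (Ioo (0 : ℝ) (a * T) ×ˢ (univ : Set E)))) (c : ℝ) :
    AEStronglyMeasurable (uncurry (FluidPDE.timeRescale a c u))
      (volume.restrict (Ioo (0 : ℝ) T ×ˢ (univ : Set E))) := by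
  have hpre : stAffine a 1 0 (0 : E) ⁻¹' (Ioo (0 : ℝ) (a * T) ×ˢ (univ : Set E)) = Ioo 0 T ×ˢ univ := by
    ext ⟨s, y⟩
    simp only [mem_preimage, stAffine_apply, zero_add, one_smul, mem_prod, mem_Ioo, mem_univ,
      and_true]
    constructor
    · rintro ⟨h1, h2⟩
      exact ⟨pos_of_mul_pos_right h1 ha.le, lt_of_mul_lt_mul_left h2 ha.le⟩
    · rintro ⟨h1, h2⟩
      exact ⟨mul_pos ha h1, mul_lt_mul_of_pos_left h2 ha⟩
  have hq : Measure.QuasiMeasurePreserving (stAffine a 1 0 (0 : E))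
      (volume.restrict (Ioo (0 : ℝ) T ×ˢ (univ : Set E)))
      (volume.restrict (Ioo (0 : ℝ) (a * T) ×ˢ (univ : Set E))) := by
    refine ⟨measurable_stAffine _ _ _ _, ?_⟩
    have hmap := map_stAffine_volume_restrict_preimage ha one_pos 0 (0 : E)
      (Ioo (0 : ℝ) (a * T) ×ˢ (univ : Set E))
    rw [hpre] at hmap
    rw [hmap]
    exact Measure.smul_absolutelyContinuous
  have h2 : uncurry (FluidPDE.timeRescale a c u) =
      fun z => c • (uncurry u ∘ stAffine a 1 0 (0 : E)) z := by
    funext ⟨s, y⟩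
    simp [timeRescale_apply, stAffine]
  rw [h2]
  exact (hu.comp_quasiMeasurePreserving hq).const_smul c

end Measurability

/-! ### The unit-viscosity statement and the reduction -/

section Unit

/-- Local notation for physical space `ℝ³ = EuclideanSpace ℝ (Fin 3)`. -/
local notation "ℝ³" => EuclideanSpace ℝ (Fin 3)

/-- **Kato's weighted local existence theorem in `L³(ℝ³)` at unit viscosity** (Kato 1984,
Thm. 1 with §1, "we may assume `ν = 1`"; Lemarié-Rieusset 2016, Thm. 7.5 and its proof, PDF
pp. 155–158: the fixed point `u = U - B(u,u)` in Kato's weighted class as soon as the free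
evolution is small there, with the weighted `L^∞` estimate; Giga 1986, Thm. 4, (4.6)–(4.7)).
The instance `ν = 1` of the tree's `kato_local_L3` (`MildL3Smooth.lean`): there is an absolute
`δ₀ > 0` such that for `T₀ > 0` and `u₀ ∈ L³(ℝ³)` weakly divergence free with
`t^{1/4} ‖e^{tΔ}u₀‖_{L⁶} ≤ δ₀` for all `t ∈ (0, T₀)`, there is an unforced mild solution `u` on
`[0, T₀)` from `u₀` with viscosity `1` (duality form), `u ∈ C([0,T₀); L³)`, `u(0) = u₀`, `u`
jointly measurable on `(0,T₀) × ℝ³`, and `‖u(t)‖_{L^∞} ≤ C t^{-1/2}` on `(0, T₀)` for some `C`.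
Equivalent to `kato_local_L3` (`kato_local_L3_iff_unit`). [cite: Kato1984, Thm. 1] [cite: LemarieRieusset2016, Thm. 7.5 (proof, PDF pp. 155–158)] -/
def kato_local_L3_unit : Prop :=
  ∃ δ₀ : ℝ, 0 < δ₀ ∧
    ∀ {T₀ : ℝ} (_hT₀ : 0 < T₀) {u₀ : ℝ³ → ℝ³}
      (_hu₀ : MemLp u₀ 3 volume) (_hdiv : FluidPDE.IsWeaklyDivFree u₀)
      (_hsmall : ∀ t ∈ Ioo 0 T₀, ENNReal.ofReal (t ^ (1 / 4 : ℝ)) *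
          eLpNorm (UnboundedOperators.heatExtension u₀ t) 6 volume ≤ ENNReal.ofReal δ₀),
      ∃ u : ℝ → ℝ³ → ℝ³,
        FluidPDE.IsMildNSSolutionOn (Ico 0 T₀) 1 0 u₀ u ∧
          FluidPDE.ContinuousInLpOn (Ico 0 T₀) 3 u ∧ u 0 = u₀ ∧
          AEStronglyMeasurable (uncurry u) (volume.restrict (Ioo 0 T₀ ×ˢ univ)) ∧
          ∃ C : ℝ, ∀ t ∈ Ioo 0 T₀, eLpNorm (u t) ∞ volume ≤ ENNReal.ofReal (C / Real.sqrt t)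

/-- **`kato_local_L3` from its unit-viscosity form** (Kato 1984, §1: "we may assume `ν = 1`";
Rusin–Šverák 2011, §1). Given `ν > 0` and `u₀` with `t^{1/4}‖e^{νtΔ}u₀‖₆ ≤ δ₀ν^{3/4}` on
`(0, T₀)`, the datum `w₀ = ν⁻¹u₀` satisfies the unit hypothesis on `(0, νT₀)`
(`s^{1/4}‖e^{sΔ}w₀‖₆ = ν^{-3/4} t^{1/4}‖e^{νtΔ}u₀‖₆`, `s = νt`); if `w` is the unit solution from
`w₀` then `u(t) = ν w(νt)` (`Fluid.timeRescale ν ν w`) is a mild solution with viscosity `ν` from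
`u₀` on `[0, T₀)` (`IsMildNSSolutionOn.timeRescale`), in `C([0,T₀); L³)`
(`ContinuousInLpOn.timeRescale`), measurable (`aestronglyMeasurable_uncurry_timeRescale_Ioo`),
with `u(0) = u₀` and `‖u(t)‖_∞ = ν‖w(νt)‖_∞ ≤ C√ν t^{-1/2}`. [cite: Kato1984, Thm. 1 and §1] -/
theorem kato_local_L3_of_unit (h : kato_local_L3_unit) : kato_local_L3 := by
  obtain ⟨δ₀, hδ₀, h⟩ := h
  refine ⟨δ₀, hδ₀, fun {ν T₀} hν hT₀ {u₀} hu₀ hdiv hsmall => ?_⟩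
  have hν0 : ν ≠ 0 := hν.ne'
  -- unit-viscosity data `w₀ = ν⁻¹ u₀` on the window `(0, ν T₀)`
  set w₀ : ℝ³ → ℝ³ := ν⁻¹ • u₀ with hw₀_def
  have hS₀ : 0 < ν * T₀ := mul_pos hν hT₀
  have hw₀ : MemLp w₀ 3 volume := hu₀.const_smul ν⁻¹
  have hw₀div : IsWeaklyDivFree w₀ := hdiv.const_smul ν⁻¹
  have hw₀small : ∀ s ∈ Ioo 0 (ν * T₀), ENNReal.ofReal (s ^ (1 / 4 : ℝ)) *
      eLpNorm (UnboundedOperators.heatExtension w₀ s) 6 volume ≤ ENNReal.ofReal δ₀ := by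
    intro s hs
    set t : ℝ := ν⁻¹ * s with ht_def
    have hst : s = ν * t := by rw [ht_def, ← mul_assoc, mul_inv_cancel₀ hν0, one_mul]
    have ht : t ∈ Ioo 0 T₀ := by
      refine ⟨by rw [ht_def]; exact mul_pos (inv_pos.2 hν) hs.1, ?_⟩
      have h2 := hs.2
      rw [hst] at h2
      exact lt_of_mul_lt_mul_left h2 hν.le
    have hlin : UnboundedOperators.heatExtension w₀ s =
        ν⁻¹ • UnboundedOperators.heatExtension u₀ (ν * t) := by
      funext x
      rw [hst]
      exact UnboundedOperators.heatExtension_const_smul ν⁻¹ u₀ (ν * t) x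
    rw [hlin, eLpNorm_const_smul, hst]
    have hkey := hsmall t ht
    -- `(νt)^{1/4} ν⁻¹ = ν^{-3/4} t^{1/4}`
    have hpow : (ν * t) ^ (1 / 4 : ℝ) * ν⁻¹ = ν ^ (-(3 / 4 : ℝ)) * t ^ (1 / 4 : ℝ) := by
      rw [Real.mul_rpow hν.le ht.1.le]
      have h1 : ν ^ (1 / 4 : ℝ) * ν⁻¹ = ν ^ (-(3 / 4 : ℝ)) := by
        rw [← Real.rpow_neg_one, ← Real.rpow_add hν]
        norm_num
      calc ν ^ (1 / 4 : ℝ) * t ^ (1 / 4 : ℝ) * ν⁻¹ = ν ^ (1 / 4 : ℝ) * ν⁻¹ * t ^ (1 / 4 : ℝ) := by ring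
        _ = ν ^ (-(3 / 4 : ℝ)) * t ^ (1 / 4 : ℝ) := by rw [h1]
    have hνinv : ‖ν⁻¹‖ₑ = ENNReal.ofReal ν⁻¹ := Real.enorm_eq_ofReal (inv_nonneg.2 hν.le)
    calc ENNReal.ofReal ((ν * t) ^ (1 / 4 : ℝ)) *
          (‖ν⁻¹‖ₑ * eLpNorm (UnboundedOperators.heatExtension u₀ (ν * t)) 6 volume)
        = ENNReal.ofReal (ν ^ (-(3 / 4 : ℝ))) * (ENNReal.ofReal (t ^ (1 / 4 : ℝ)) *
            eLpNorm (UnboundedOperators.heatExtension u₀ (ν * t)) 6 volume) := by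
          rw [hνinv, ← mul_assoc, ← ENNReal.ofReal_mul (Real.rpow_nonneg (mul_nonneg hν.le ht.1.le) _),
            hpow, ENNReal.ofReal_mul (Real.rpow_nonneg hν.le _), mul_assoc]
      _ ≤ ENNReal.ofReal (ν ^ (-(3 / 4 : ℝ))) * ENNReal.ofReal (δ₀ * ν ^ (3 / 4 : ℝ)) :=
          mul_le_mul' le_rfl hkey
      _ = ENNReal.ofReal δ₀ := by
          rw [← ENNReal.ofReal_mul (Real.rpow_nonneg hν.le _)]
          congr 1
          rw [mul_comm δ₀, ← mul_assoc, ← Real.rpow_add hν]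
          norm_num
  -- the unit solution and its rescaling
  obtain ⟨w, hw, hwc, hw0, hwm, C, hC⟩ := h hS₀ hw₀ hw₀div hw₀small
  set u : ℝ → ℝ³ → ℝ³ := FluidPDE.timeRescale ν ν w with hu_def
  have hmaps : MapsTo (fun t => ν * t) (Ico 0 T₀) (Ico 0 (ν * T₀)) := fun t ht =>
    ⟨mul_nonneg hν.le ht.1, mul_lt_mul_of_pos_left ht.2 hν⟩
  have hνw₀ : ν • w₀ = u₀ := by
    rw [hw₀_def, smul_smul, mul_inv_cancel₀ hν0, one_smul]
  refine ⟨u, ?_, hwc.timeRescale ν hmaps, ?_, ?_, C * Real.sqrt ν, fun t ht => ?_⟩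
  · -- mild solution with viscosity `ν · 1 = ν`, datum `ν • w₀ = u₀`, force `0`
    have h1 := hw.timeRescale hν hmaps
    have hf : FluidPDE.timeRescale ν (ν ^ 2) (0 : ℝ → ℝ³ → ℝ³) = 0 := by
      funext s x
      simp [timeRescale_apply]
    rw [hf, hνw₀, mul_one] at h1
    exact h1
  · -- `u 0 = u₀`
    funext x
    simp only [hu_def, timeRescale_apply, mul_zero, hw0]
    rw [← hνw₀]
    rfl
  · -- measurability on `(0, T₀) × ℝ³`
    exact aestronglyMeasurable_uncurry_timeRescale_Ioo hν hwm ν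
  · -- the weighted `L^∞` bound, constant `C √ν`
    have hνt : ν * t ∈ Ioo 0 (ν * T₀) := ⟨mul_pos hν ht.1, mul_lt_mul_of_pos_left ht.2 hν⟩
    have hut : u t = ν • w (ν * t) := by
      funext x
      simp [hu_def, timeRescale_apply]
    rw [hut, eLpNorm_const_smul, Real.enorm_eq_ofReal hν.le]
    calc ENNReal.ofReal ν * eLpNorm (w (ν * t)) ∞ volume
        ≤ ENNReal.ofReal ν * ENNReal.ofReal (C / Real.sqrt (ν * t)) := mul_le_mul' le_rfl (hC _ hνt)
      _ = ENNReal.ofReal (C * Real.sqrt ν / Real.sqrt t) := by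
          rw [← ENNReal.ofReal_mul hν.le]
          congr 1
          have hsν : 0 < Real.sqrt ν := Real.sqrt_pos.2 hν
          have hst : 0 < Real.sqrt t := Real.sqrt_pos.2 ht.1
          rw [Real.sqrt_mul hν.le]
          field_simp
          rw [Real.sq_sqrt hν.le]
          ring

/-- The trivial direction: `kato_local_L3` contains its instance `ν = 1`. [cite: Kato1984, Thm. 1] -/
theorem kato_local_L3_unit_of (h : kato_local_L3) : kato_local_L3_unit := by
  obtain ⟨δ₀, hδ₀, h⟩ := h
  refine ⟨δ₀, hδ₀, fun {T₀} hT₀ {u₀} hu₀ hdiv hsmall => ?_⟩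
  have hsmall' : ∀ t ∈ Ioo 0 T₀, ENNReal.ofReal (t ^ (1 / 4 : ℝ)) *
      eLpNorm (UnboundedOperators.heatExtension u₀ (1 * t)) 6 volume ≤
        ENNReal.ofReal (δ₀ * (1 : ℝ) ^ (3 / 4 : ℝ)) := fun t ht => by
    simpa only [one_mul, Real.one_rpow, mul_one] using hsmall t ht
  exact h one_pos hT₀ hu₀ hdiv hsmall'

/-- **`kato_local_L3` is equivalent to its unit-viscosity form.** [cite: Kato1984, Thm. 1 and §1] -/
theorem kato_local_L3_iff_unit : kato_local_L3 ↔ kato_local_L3_unit :=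
  ⟨kato_local_L3_unit_of, kato_local_L3_of_unit⟩

end Unit

end Literature.Analysis.FluidPDE
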